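import Summits.BirchSwinnertonDyer.Rank1Residual.Additive.TwistedBranchPAdicGrossZagier
import Summits.BirchSwinnertonDyer.Rank1Residual.Additive.CensusX42BSDMult
import HarnessLib

/-!
# Row B6 (O7-ord), defect 2, sequel: the named fact `delbourgoDatum_rankOne_leadingTerms`
# (Delbourgo 2002 (B) ∘ PROOF-gz Thm. 1, ONE datum) + a PUBLISHED Kato/Wuthrich half + ONE number
# per pair ⟹ `BSD(E,p)` in analytic rank one on (G-ord, `e = 2`) (`p ≥ 5`) and on (M) (every odd `p`)
# (cell `bsd-addord`, FULL-BSD rank-≤ 1 programme D-0033 tranche 1a, seat `bsd-addord-gz`, session 3;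
# planner rulings R-O7 (2) / R-O7″ (1)(3), `run/shared/lean/pub/bsd-addord/TARGET.md` §8; sequel of
# `TwistedBranchPAdicGrossZagier.lean`)

HONEST FRAMING. Theorems only: no definition, no named fact minted here, no `sorry`, nothing booked,
no label of the residual map changed. The ONE non-published input is DISPLAYED as the hypothesis
`(hFact : delbourgoDatum_rankOne_leadingTerms)` — the named fact of
`Literature/NumberTheory/EllipticCurves/Disegni2017/TwistedBranchLeadingTerm.lean` (gate p402187): "for
`W` globally minimal without CM, `p` odd additive, `r_an = 1`, under the PRINTED hypotheses of
Delbourgo 2002 Thm. (B), ONE height datum `Dh` (Delbourgo's `⟨,⟩_{p,ℚ}`) satisfies both Delbourgo's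
(B)-clauses and the twisted-branch Gross–Zagier clauses". Its (B)-half is Delbourgo, J. Number Theory
95 (2002) Thm. (B) (refereed print); its Gross–Zagier half is a CELL THEOREM: PROOF-gz.md Thm. 1
(text of record v1, sha256 63cb6b30a0a95466…, archived v1.3 = v1 + GZ-H under
`run/shared/lean/pub/bsd-addord/frozen/`), proved on paper from Disegni 2017 Thm. A/B (+ Disegni 2022
Thm. B and its 2025 Correction on (M)), Yuan–Zhang–Zhang, Mazur–Tate–Teitelbaum, Perrin-Riou
(calibration) and Pal; cross-family referee verdict **REF-gz: PASS (Theorem 1, Cor. 2, Cor. 3) with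
condition GZ-H** (`run/shared/lean/pub/bsd-addord/REF-gz.md`, 2026-08-25). It is NOT a theorem in
print and NOT asserted in the tree; every consumer below takes it as a binder.

REFEREE CONDITION GZ-H (binding locator sentence, carried verbatim in substance here and on every
declaration below whose statement covers the locus (M) ∩ {`V` split multiplicative}): the
identification of Disegni's canonical `p`-adic height with Schneider's norm-adapted height used in
PROOF-gz §3.3 (Lemma H) is the (n-exc)-CONDITIONAL printed sentence Disegni, Compos. Math. 153 (2017)
Rem. 1.3.2 (arXiv v3 p. 9 = TeX p0007 L48) together with Disegni, Invent. Math. 230 (2022) Thm. B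
context (TeX p0007 L55–62: under (n-exc) the canonical height coincides with all other `p`-adic height
pairings), with (n-exc) DISCHARGED because `ε_p` is ramified (PROOF-gz 3.1 (iv): `Z_w ≠ 0` also for
split `V`); it is NOT Delbourgo 2002 p. 62's unconditional sentence, and Nekovář 1993 §7.14 (the
sentence's source) is not held on the hub (acq-10827), so the verification trail is the printed
statements of Disegni 2017/2022.

## What

FOUR per-pair pipelines to `BSDp W p` in analytic rank one, each = [the fact `hFact`] +
[a PUBLISHED divisibility: Kato 2004 Thm. 17.4 (3) on the half eigenspace (`hK`, X4, `ρ̄` onto) or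
Wuthrich 2014 Thm. 16 (`hWu`/`hW16`, X3)] + [modularity `hmodD`, `hmod`; GZK `hGZK`] + [ONE NUMBER: the
certificate `BranchUnitCertificateAt W p` ((G-ord, `e = 2`), `p ≥ 5`, non-anomalous) resp.
`MultBranchUnitCertificateAt W p` ((M), every odd `p`)], through the tree's
`ClassX4Gord/ClassX3Gord.bsdp_iff_padicVal_rankOne_of_{kato,wuthrich}Half_of_cert` and
`ClassX4M/ClassX3M.bsdp_iff_padicVal_rankOne_of_{kato,wuthrich}Half_of_multCert`
(`BSD(E,p) ⟺ ord_p q + ord_p Reg_p(Dh) = 1` for a (B)-datum) and the prequel's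
`padicValRat_add_valuation_eq_one_of_twisted_identity`. Delbourgo's printed hypotheses are discharged
in the kernel from the class predicates (`ClassX4Gord.typeGOrd`, `PotMult`).

## What is NOT claimed

No booking; no main-conjecture equality beyond what Kato/Wuthrich + the unit certificate force at the
pair; nothing at defect `3,4,6` (that is `TameBranchGrossZagier.lean`, PROOF-gz2), at a potentially
supersingular `p`, at `p = 2`, in rank `≠ 1`; nothing on (G-ord, `e = 2`) at `p = 3` (the Gord
consumers used here carry `5 ≤ p`); Schneider class-wide; the sign of `u`.

References: [Disegni2017] Thm. A, B, Rem. 1.3.2; [Delbourgo2002] Thm. (A), (B) p. 40, `⟨,⟩_{p,ℚ}` p. 39,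
hypothesis (M) p. 39; [Kato2004Asterisque] Thm. 17.4 (3); [Wuthrich2014] Thm. 16;
[MazurTateTeitelbaum1986Invent] §I.10, §I.13–I.14; [Miller2011LMS] Def. 1.1; cell memo PROOF-gz.md §3,
§5, §8.
-/

noncomputable section

open scoped Classical MatrixGroups ModularForm NumberField

open CongruenceSubgroup WeierstrassCurve NumberField IsDedekindDomain
  Literature.NumberTheory.EllipticCurves Literature.NumberTheory.EllipticCurves.ModularForms
  Literature.NumberTheory.EllipticCurves.Rank1Residual
  Literature.NumberTheory.EllipticCurves.Rank1Residual.Typed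
  Literature.NumberTheory.EllipticCurves.Delbourgo2002
  Literature.NumberTheory.EllipticCurves.Disegni2017

namespace Summit.BirchSwinnertonDyer.Rank1Residual.Additive

variable {W : WeierstrassCurve ℚ} [W.IsElliptic] [W.IsGloballyMinimal] {p : ℕ} [hp : Fact p.Prime]

/-! ### The per-pair pipelines: fact + Kato/Wuthrich half + ONE number ⟹ `BSD(E,p)` in rank one -/

/-- **X4♯(G-ord) ∩ `I₀*` (`e = 2`) ∩ {`ρ̄` onto}, `p ≥ 5`, `E` non-CM, `r_an = 1`, non-anomalous, with
the one-number certificate `BranchUnitCertificateAt W p`: the named fact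
`delbourgoDatum_rankOne_leadingTerms` (PROOF-gz Thm. 1 ∘ Delbourgo 2002 (B), DISPLAYED as `hFact`) gives
`BSD(E,p)`** — through additive-p2's `ClassX4Gord.bsdp_iff_padicVal_rankOne_of_katoHalf_of_cert`
(`BSD(E,p) ⟺ ord_p q + ord_p Reg_p(Dh) = 1` for a (B)-datum) and the prequel's §2 (`ord_p log_p γ = 1`,
`‖ϖ[T¹]B‖ = 1`, `u` a unit). Published binders: Kato 2004 Thm. 17.4 (3) on the half eigenspace (`hK`),
modularity (`hmodD`, `hmod`), GZK (`hGZK`); Delbourgo's printed (G)-hypothesis is `ClassX4Gord.typeGOrd`.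
[cite: Delbourgo2002, Theorem (A), (B) (p. 40)] [cite: Kato2004Asterisque, Thm. 17.4 (3) (p. 273)]
[cite: Miller2011LMS, Def. 1.1] -/
theorem ClassX4Gord.bsdp_rankOne_of_delbourgoDatumFact_of_katoHalf_of_cert
    (hFact : delbourgoDatum_rankOne_leadingTerms)
    (hK : Wuthrich2014.kato_halfEigenCharIdeal_dvd_cyclotomicPrime_of_surjective)
    (hmodD : nonempty_modularParametrizationData)
    (hGZK : rank_eq_analyticRank_of_analyticRank_le_one) (hmod : hasEntireLFunction_rat)
    (hX : ClassX4Gord W p) (hp5 : 5 ≤ p) (hcm : ¬ W.HasCM) (he : semistabilityIndex W p = 2)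
    (hsurj : Surj W p) (hr : W.analyticRank = 1) (hna : ReductionNonAnomalous W p)
    (hcert : BranchUnitCertificateAt W p) : BSDp W p := by
  have hp2 : p ≠ 2 := by omega
  have hodd : p % 4 = 1 ∨ p % 4 = 3 := by
    obtain ⟨k, hk⟩ := hp.out.odd_of_ne_two hp2
    omega
  have hH : Delbourgo2002PrintedHypotheses W p := Or.inl ⟨hp5, hX.typeGOrd⟩
  obtain ⟨Dh, hB, hTw⟩ := hFact W p hp2 hcm hX.addv.2 hr hH
  obtain ⟨V, iV, iVm, C, hV, hC⟩ := hX.exists_goodOrd_pStar_twist_model W p he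
  haveI : NeZero (V.conductorNorm ℤ) := ⟨(V.conductorNorm_pos_holds).ne'⟩
  obtain ⟨Dm⟩ := hmodD V
  obtain ⟨ϖ, hϖ⟩ := exists_periodRatio_parity (p := p) V Dm
  have hord : IsOrdinaryAt V p := hV
  obtain ⟨-, hone⟩ := hcert V C hC hord Dm.f Dm.isNewformOf ϖ hϖ
  obtain ⟨q, hLq, heven, hoddc⟩ := hTw hr V Dm.f (Or.inl hord.1) Dm.isNewformOf
  have hq : q ≠ 0 := by
    rintro rfl
    rw [Rat.cast_zero, zero_mul, zero_mul] at hLq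
    exact W.leadingLCoeff_ne_zero_holds (hmod W) hLq
  rw [hX.bsdp_iff_padicVal_rankOne_of_katoHalf_of_cert hK hmodD hGZK hmod hp5 he hsurj hr hna hcert hB
    hLq]
  rcases hodd with h1 | h3
  · have hev : Even (p / 2) := ⟨p / 4, by omega⟩
    rw [if_pos hev] at hϖ hone
    have hC' : C • V.quadraticTwist (p : ℚ) = W := by
      rw [pStar_eq_of_mod_four p (Or.inl h1), if_pos h1] at hC
      exact hC
    obtain ⟨u, hu⟩ := (heven C ϖ h1 hC' hϖ).1 hord
    rw [PowerSeries.coeff_C_mul] at hone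
    exact (padicValRat_add_valuation_eq_one_of_twisted_identity W hp2 hq hone hu).2
  · have hne : ¬ Even (p / 2) := by
      rw [Nat.not_even_iff_odd]
      exact ⟨p / 4, by omega⟩
    rw [if_neg hne] at hϖ hone
    have hC' : C • V.quadraticTwist (-(p : ℚ)) = W := by
      rw [pStar_eq_of_mod_four p (Or.inr h3), if_neg (by omega)] at hC
      exact hC
    obtain ⟨u, hu⟩ := (hoddc C ϖ h3 hC' hϖ).1 hord
    rw [PowerSeries.coeff_C_mul] at hone
    exact (padicValRat_add_valuation_eq_one_of_twisted_identity W hp2 hq hone hu).2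

/-- **X3 twin**: X3♯(G-ord) ∩ `I₀*` (`E[p]` reducible, `e = 2`), `p ≥ 5`, `E` non-CM, `r_an = 1`,
non-anomalous, certificate `BranchUnitCertificateAt W p`: the named fact (`hFact`) + Wuthrich 2014
Thm. 16 on the half eigenspace (`hWu`) ⟹ `BSD(E,p)`. [cite: Delbourgo2002, Theorem (A), (B) (p. 40)]
[cite: Wuthrich2014, Thm. 16 (p. 397)] [cite: Miller2011LMS, Def. 1.1] -/
theorem ClassX3Gord.bsdp_rankOne_of_delbourgoDatumFact_of_wuthrichHalf_of_cert
    (hFact : delbourgoDatum_rankOne_leadingTerms)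
    (hWu : Wuthrich2014.thm16_halfEigenCharIdeal_dvd_cyclotomicPrime)
    (hmodD : nonempty_modularParametrizationData)
    (hGZK : rank_eq_analyticRank_of_analyticRank_le_one) (hmod : hasEntireLFunction_rat)
    (hX : ClassX3Gord W p) (hp5 : 5 ≤ p) (hcm : ¬ W.HasCM) (he : semistabilityIndex W p = 2)
    (hr : W.analyticRank = 1) (hna : ReductionNonAnomalous W p)
    (hcert : BranchUnitCertificateAt W p) : BSDp W p := by
  have hp2 : p ≠ 2 := by omega
  have hodd : p % 4 = 1 ∨ p % 4 = 3 := by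
    obtain ⟨k, hk⟩ := hp.out.odd_of_ne_two hp2
    omega
  have hH : Delbourgo2002PrintedHypotheses W p := Or.inl ⟨hp5, hX.typeGOrd⟩
  obtain ⟨Dh, hB, hTw⟩ := hFact W p hp2 hcm hX.addv hr hH
  obtain ⟨V, iV, iVm, C, hV, hC⟩ := hX.exists_goodOrd_pStar_twist_model W p hp2 he
  haveI : NeZero (V.conductorNorm ℤ) := ⟨(V.conductorNorm_pos_holds).ne'⟩
  obtain ⟨Dm⟩ := hmodD V
  obtain ⟨ϖ, hϖ⟩ := exists_periodRatio_parity (p := p) V Dm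
  have hord : IsOrdinaryAt V p := hV
  obtain ⟨-, hone⟩ := hcert V C hC hord Dm.f Dm.isNewformOf ϖ hϖ
  obtain ⟨q, hLq, heven, hoddc⟩ := hTw hr V Dm.f (Or.inl hord.1) Dm.isNewformOf
  have hq : q ≠ 0 := by
    rintro rfl
    rw [Rat.cast_zero, zero_mul, zero_mul] at hLq
    exact W.leadingLCoeff_ne_zero_holds (hmod W) hLq
  rw [hX.bsdp_iff_padicVal_rankOne_of_wuthrichHalf_of_cert hWu hmodD hGZK hmod hp5 he hr hna hcert hB hLq]
  rcases hodd with h1 | h3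
  · have hev : Even (p / 2) := ⟨p / 4, by omega⟩
    rw [if_pos hev] at hϖ hone
    have hC' : C • V.quadraticTwist (p : ℚ) = W := by
      rw [pStar_eq_of_mod_four p (Or.inl h1), if_pos h1] at hC
      exact hC
    obtain ⟨u, hu⟩ := (heven C ϖ h1 hC' hϖ).1 hord
    rw [PowerSeries.coeff_C_mul] at hone
    exact (padicValRat_add_valuation_eq_one_of_twisted_identity W hp2 hq hone hu).2
  · have hne : ¬ Even (p / 2) := by
      rw [Nat.not_even_iff_odd]
      exact ⟨p / 4, by omega⟩
    rw [if_neg hne] at hϖ hone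
    have hC' : C • V.quadraticTwist (-(p : ℚ)) = W := by
      rw [pStar_eq_of_mod_four p (Or.inr h3), if_neg (by omega)] at hC
      exact hC
    obtain ⟨u, hu⟩ := (hoddc C ϖ h3 hC' hϖ).1 hord
    rw [PowerSeries.coeff_C_mul] at hone
    exact (padicValRat_add_valuation_eq_one_of_twisted_identity W hp2 hq hone hu).2

open Summit.BirchSwinnertonDyer.Rank1Residual.AdditivePotMult in
/-- **X4(M) ∩ {`ρ̄` onto}, EVERY odd `p`, `r_an = 1`, with the one-number (M) certificate
`MultBranchUnitCertificateAt W p`: the named fact (`hFact`) ⟹ `BSD(E,p)`** — through n1011-p07's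
`ClassX4M.bsdp_iff_padicVal_rankOne_of_katoHalf_of_multCert` (`BSD(E,p) ⟺ ord_p q + ord_p Reg_p(Dh) = 1`,
no `ℓ`, no `5 ≤ p`, no anomalous binder) and the prequel's §2. Delbourgo 2002 (M)'s printed hypotheses are discharged
on (M) in the kernel (`PotMult`: additive, `ord_p j < 0`, no CM, the twist witness). GZ-H (REF-gz.md,
binding on this (M) statement, which covers `E♭` split multiplicative): the height identification
behind `hFact`'s Gross–Zagier half on (M) ∩ {`V` split} is the (n-exc)-conditional printed sentence
Disegni 2017 Rem. 1.3.2 (TeX p0007 L48) + Disegni 2022 Thm. B context (TeX p0007 L55–62), (n-exc)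
discharged by `ε_p` ramified (PROOF-gz 3.1 (iv)); not Delbourgo 2002 p. 62; Nekovář 1993 §7.14 unheld
(acq-10827). [cite: Delbourgo2002, Theorem (A), (B) (p. 40), hypothesis (M) (p. 39)]
[cite: Kato2004Asterisque, Thm. 17.4 (3) (p. 273)] [cite: Miller2011LMS, Def. 1.1] -/
theorem ClassX4M.bsdp_rankOne_of_delbourgoDatumFact_of_katoHalf_of_multCert
    (hFact : delbourgoDatum_rankOne_leadingTerms)
    (hK : Wuthrich2014.kato_halfEigenCharIdeal_dvd_cyclotomicPrime_of_surjective)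
    (hmodD : nonempty_modularParametrizationData)
    (hGZK : rank_eq_analyticRank_of_analyticRank_le_one) (hmod : hasEntireLFunction_rat)
    (hX : ClassX4M W p) (hsurj : Surj W p) (hr : W.analyticRank = 1)
    (hcert : MultBranchUnitCertificateAt W p) : BSDp W p := by
  have hp2 : p ≠ 2 := hX.p_ne_two
  have hodd : p % 4 = 1 ∨ p % 4 = 3 := by
    obtain ⟨k, hk⟩ := hp.out.odd_of_ne_two hp2
    omega
  have hH : Delbourgo2002PrintedHypotheses W p :=
    Or.inr (Or.inl ⟨hX.potMult.2, hX.potMult.exists_quadraticTwist_mult hp2⟩)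
  obtain ⟨Dh, hB, hTw⟩ := hFact W p hp2 hX.potMult.not_hasCM hX.potMult.1 hr hH
  obtain ⟨V, iV, iVm, C, hV, hC⟩ := hX.exists_mult_pStar_twist_model
  haveI : NeZero (V.conductorNorm ℤ) := ⟨(V.conductorNorm_pos_holds).ne'⟩
  obtain ⟨Dm⟩ := hmodD V
  obtain ⟨ϖ, hϖ⟩ := exists_periodRatio_parity (p := p) V Dm
  obtain ⟨-, hone⟩ := hcert V C hV hC Dm.f Dm.isNewformOf (V.LFunction p) (Dm.isNewformOf.2 p) ϖ hϖ
  obtain ⟨q, hLq, heven, hoddc⟩ := hTw hr V Dm.f (Or.inr hV) Dm.isNewformOf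
  have hq : q ≠ 0 := by
    rintro rfl
    rw [Rat.cast_zero, zero_mul, zero_mul] at hLq
    exact W.leadingLCoeff_ne_zero_holds (hmod W) hLq
  rw [hX.bsdp_iff_padicVal_rankOne_of_katoHalf_of_multCert hK hmodD hGZK hmod hsurj hr hcert hB hLq]
  rcases hodd with h1 | h3
  · have hev : Even (p / 2) := ⟨p / 4, by omega⟩
    rw [if_pos hev] at hϖ hone
    have hC' : C • V.quadraticTwist (p : ℚ) = W := by
      rw [pStar_eq_of_mod_four p (Or.inl h1), if_pos h1] at hC
      exact hC
    obtain ⟨u, hu⟩ := (heven C ϖ h1 hC' hϖ).2 hV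
    rw [PowerSeries.coeff_C_mul] at hone
    exact (padicValRat_add_valuation_eq_one_of_twisted_identity W hp2 hq hone hu).2
  · have hne : ¬ Even (p / 2) := by
      rw [Nat.not_even_iff_odd]
      exact ⟨p / 4, by omega⟩
    rw [if_neg hne] at hϖ hone
    have hC' : C • V.quadraticTwist (-(p : ℚ)) = W := by
      rw [pStar_eq_of_mod_four p (Or.inr h3), if_neg (by omega)] at hC
      exact hC
    obtain ⟨u, hu⟩ := (hoddc C ϖ h3 hC' hϖ).2 hV
    rw [PowerSeries.coeff_C_mul] at hone
    exact (padicValRat_add_valuation_eq_one_of_twisted_identity W hp2 hq hone hu).2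

open Summit.BirchSwinnertonDyer.Rank1Residual.AdditivePotMult in
/-- **X3♯(M) twin**, EVERY odd `p`, `r_an = 1`, (M) certificate `MultBranchUnitCertificateAt W p`,
Wuthrich 2014 Thm. 16 on the half eigenspace (`hW16`, reducible `E[p]`): the named fact (`hFact`) ⟹
`BSD(E,p)`. GZ-H (REF-gz.md, binding on this (M) statement, which covers `E♭` split multiplicative): the
height identification behind `hFact`'s Gross–Zagier half on (M) ∩ {`V` split} is the
(n-exc)-conditional printed sentence Disegni 2017 Rem. 1.3.2 (TeX p0007 L48) + Disegni 2022 Thm. B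
context (TeX p0007 L55–62), (n-exc) discharged by `ε_p` ramified (PROOF-gz 3.1 (iv)); not Delbourgo
2002 p. 62; Nekovář 1993 §7.14 unheld (acq-10827). [cite: Delbourgo2002, Theorem (A), (B) (p. 40), hypothesis (M) (p. 39)]
[cite: Wuthrich2014, Thm. 16 (p. 397)] [cite: Miller2011LMS, Def. 1.1] -/
theorem ClassX3M.bsdp_rankOne_of_delbourgoDatumFact_of_wuthrichHalf_of_multCert
    (hFact : delbourgoDatum_rankOne_leadingTerms)
    (hW16 : Wuthrich2014.thm16_halfEigenCharIdeal_dvd_cyclotomicPrime)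
    (hmodD : nonempty_modularParametrizationData)
    (hGZK : rank_eq_analyticRank_of_analyticRank_le_one) (hmod : hasEntireLFunction_rat)
    (hX : ClassX3M W p) (hr : W.analyticRank = 1)
    (hcert : MultBranchUnitCertificateAt W p) : BSDp W p := by
  have hp2 : p ≠ 2 := ClassX3M.p_ne_two W p hX
  have hodd : p % 4 = 1 ∨ p % 4 = 3 := by
    obtain ⟨k, hk⟩ := hp.out.odd_of_ne_two hp2
    omega
  have hH : Delbourgo2002PrintedHypotheses W p :=
    Or.inr (Or.inl ⟨hX.potMult.2, hX.potMult.exists_quadraticTwist_mult hp2⟩)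
  obtain ⟨Dh, hB, hTw⟩ := hFact W p hp2 hX.potMult.not_hasCM hX.potMult.1 hr hH
  obtain ⟨V, iV, iVm, C, hV, hC⟩ := hX.exists_mult_pStar_twist_model
  haveI : NeZero (V.conductorNorm ℤ) := ⟨(V.conductorNorm_pos_holds).ne'⟩
  obtain ⟨Dm⟩ := hmodD V
  obtain ⟨ϖ, hϖ⟩ := exists_periodRatio_parity (p := p) V Dm
  obtain ⟨-, hone⟩ := hcert V C hV hC Dm.f Dm.isNewformOf (V.LFunction p) (Dm.isNewformOf.2 p) ϖ hϖ
  obtain ⟨q, hLq, heven, hoddc⟩ := hTw hr V Dm.f (Or.inr hV) Dm.isNewformOf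
  have hq : q ≠ 0 := by
    rintro rfl
    rw [Rat.cast_zero, zero_mul, zero_mul] at hLq
    exact W.leadingLCoeff_ne_zero_holds (hmod W) hLq
  rw [hX.bsdp_iff_padicVal_rankOne_of_wuthrichHalf_of_multCert hW16 hmodD hGZK hmod hr hcert hB hLq]
  rcases hodd with h1 | h3
  · have hev : Even (p / 2) := ⟨p / 4, by omega⟩
    rw [if_pos hev] at hϖ hone
    have hC' : C • V.quadraticTwist (p : ℚ) = W := by
      rw [pStar_eq_of_mod_four p (Or.inl h1), if_pos h1] at hC
      exact hC
    obtain ⟨u, hu⟩ := (heven C ϖ h1 hC' hϖ).2 hV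
    rw [PowerSeries.coeff_C_mul] at hone
    exact (padicValRat_add_valuation_eq_one_of_twisted_identity W hp2 hq hone hu).2
  · have hne : ¬ Even (p / 2) := by
      rw [Nat.not_even_iff_odd]
      exact ⟨p / 4, by omega⟩
    rw [if_neg hne] at hϖ hone
    have hC' : C • V.quadraticTwist (-(p : ℚ)) = W := by
      rw [pStar_eq_of_mod_four p (Or.inr h3), if_neg (by omega)] at hC
      exact hC
    obtain ⟨u, hu⟩ := (hoddc C ϖ h3 hC' hϖ).2 hV
    rw [PowerSeries.coeff_C_mul] at hone
    exact (padicValRat_add_valuation_eq_one_of_twisted_identity W hp2 hq hone hu).2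

end Summit.BirchSwinnertonDyer.Rank1Residual.Additive

end
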